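import Summits.QuantumFields.YangMills.Theorems.UnitScaleTiltProp7QTwSLocalGaugeComparison
import Summits.QuantumFields.YangMills.Theorems.UnitScaleTiltProp7LocalDivergenceComparison
import Summits.QuantumFields.YangMills.Theorems.UnitScaleTiltProp7QTwSectors
import Summits.QuantumFields.YangMills.Theorems.UnitScaleTiltProp7QTwSScalarSectorRegPr
import HarnessLib

/-!
# Route `UnitScaleTilt`, crux «MinimiserStabilityRegPr» (stmt-QuantumFields-19200, stub EX), γ-row `hGF[Lift]` (LOD line, ★p1 g24 LOCATE-L6-ASSEMBLY v1 §1 Step I.2),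
# pen (L5), piece (L5c) — FILE C, PART I: ★★ THE LOCAL GAUGE COMPARISON OF THE AVERAGING OPERATOR FOR ALL `M₂(ℂ)`-VALUED FIELDS, IN `SU(2)`-GAUGE LETTERS AND THE
# HILBERT–SCHMIDT CURRENCY: `Σ_{c'} Σ_{jk} |(QTwS U₀ A c' − Ad_{w(c')}(QTwS 1 (Ad_σA) c'))_{jk}|² ≤ 4·(3·10¹⁰L¹⁰ε₀² + 192(ℓδ)²)·(ℓ²∕ℓ^d)·Σ_b Σ_{jk} |A(b)_{jk}|²`

Cell `ym3-torus` (rung R3 — YM₃ on T³; NOT d = 4, NOT the Clay problem).  Width seat `ym-routeR-w4` g26 (CLAIM «MINE (L5c) FILE C» 2026-08-29 23:54Z; successor of g25's FILES A∕B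
✓`Prop7TubeStrGaugeComparison` ∕ ✓`Prop7QTwSLocalGaugeComparison`).  THEOREMS ONLY (0 `def`, 0 `sorry`); `--supports stmt-QuantumFields-19200 --as helper`; count-neutral.
PART II (✓∕⧗ `Prop7QkLocalGaugeComparison`) reads this row in the target's `L²` letters (`Q_k = η • toL2B ∘ QTwS ∘ toL2⁻¹`).

THE POINT.  FILE B (✓`Prop7QTwSLocalGaugeComparison.sum_normSq_QTwS_sub_conjR_QTwS_one_gauge_le`) is the (L5c) comparison in CARRIER letters and operator norm, for 𝔰𝔲(2)-valued
fields `B` and a `U1`-valued gauge `g`: `Σ_{c'} |QTwS U₀ B c' − Ad_{w(c')}(QTwS 1 B^g c')|² ≤ ρ·(ℓ²∕ℓ^d)·Σ_b |B b|²`, `ρ = 3·10¹⁰L¹⁰ε₀² + 192(ℓδ)²`.  The (L6) assembler works in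
the TARGET's letters ((L5a) ✓`Prop7CovariantCurlGaugeComparison`, (L5b) ✓`Prop7LocalDivergenceComparison`): an `SU(2)` gauge transformation `σ : GaugeTransf`, the gauged
background `U₀^σ = GaugeField.gaugeAct σ U₀`, the source-conjugated field `(Ad_σA)(b) = σ(b₋)A(b)σ(b₋)*` for ANY `A : bonds → M₂(ℂ)` (the target quantifies over all of `L²`),
and Hilbert–Schmidt (entrywise) sums.  This file does the translation:
* §1 two Frobenius rows: conjugation `Ad_u` by a unit with `|u|, |u⁻¹| ≤ 1` preserves `Σ_{jk}|X_{jk}|²`; the sector components of a field vanish where the field vanishes.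
* §2 the dictionary `σ ↦ g := Unitary.toUnits ∘ suIncl ∘ σ`: `g(x) ∈ U1`, `Ad_{g(b₋)}X(b) = σ(b₋)X(b)σ(b₋)*`, `(U₀♭)^g = (U₀^σ)♭`.
* §3 the scalar sector is EXACTLY flat and gauge invariant: `QTwS U₀ (τ•1) c' = Ad_w(QTwS 1 ((τ•1)^σ) c')` ((Q-b) ✓`QTwS_apply_smul_one_of_regPr`, `Ad_w 1 = 1`, `(τ•1)^σ = τ•1`).
* §4 ★★ FILE B for ALL `M₂(ℂ)`-valued `A` with constant `4ρ`: sectors `A = A₁ + I•A₂ + τ•1` (✓`exists_sector_fields`), FILE B on `A₁`, `A₂`, §3 on `τ•1`, ℂ-linearity of `QTwS` and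
  `Ad`, `|X|² ≤ Σ|X_{jk}|² ≤ 2|X|²` on `M₂` (✓`MatrixNorms.opNorm_sq_le_sum_norm_sq`, ✓`sum_norm_sq_le_two_mul_opNorm_sq`), Pythagoras ✓`sum_normSq_entries_sectors`.
HYPOTHESIS `hgood` = FILE B's, verbatim in `U₀^σ` letters: `δ`-flatness of `U₀^σ` on the comb and run walks of the tube terms on which `A ≠ 0` (discharged by the assembler from
`supp A_j ⊆ □_j`, `σ` axial on `□̃_j`, `δ = 6R″ε₀η` by ✓`norm_axialGauge_bond_sub_one_le_T3`).
HONEST SCOPE.  Bookkeeping over landed rows; (L5a)∕(L5b)∕(L5″)∕(L6), the seams, `hGF`, the print rows, `hThm2S`, EX and the crux are NOT proved here.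
References: T. Bałaban, CMP **99** (1985) 389–434 [Balaban1985BackgroundPropagators] ((3.11) p.392, (3.13)–(3.16) p.393, Thm 3.11 p.416); CMP **98** (1985) 17–51
[Balaban1985Averaging] ((8) p.19, (18)–(20) p.21, Prop. 3 (124)–(126) p.36); CMP **95** (1984) 17–40 [Balaban1984PropagatorsI] ((1.18)–(1.20) pp.19–20); CMP **99** (1985) 75–102
[Balaban1985RegularSpaces] (Lemma 1 (1.25) p.79).
-/

set_option autoImplicit false

noncomputable section

open scoped BigOperators Matrix.Norms.L2Operator Matrix

namespace Summit.QuantumFields.YangMills.Theorems.Prop7QTwSLocalGaugeComparisonAllFields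

open Literature.MathematicalPhysics.QuantumFieldTheory.Balaban1983to89
open Literature.MathematicalPhysics.QuantumFieldTheory.Balaban1983to89.T3ContinuumYM3Torus
open Finset T4Continuum BlockAveraging AveragingRT ExpMeanLog BlockAveragingEMLLinearised BlockAveragingEMLLinearisedBackground BlockAveragingEMLProp2 LatticeFieldCalculus
open B7Prop1Explicit (U1 mem_U1 treeWord)
open B7Prop2SpecialUnitary (specialUnitaryUnits mem_specialUnitaryUnits specialUnitaryUnits_le_U1)
open B7Eq78Linearization (conjR conjR_apply conjR_sub conjR_smul conjR_add conjR_one)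
open B8Ineq132 (conjR_conjR one_conjR)
open B10Eq27TorusAxialLog (axialT gaugeActT gaugeActT_apply unitsField toUField suIncl val_unitsField)
open B15DeterminingSets (embIter)
open T3LevelShift (bondShift)
open T3PrintedRegularOrbits (sites_eq)
open T3PrintedRegularMinimiser (RegPr)
open Summit.QuantumFields.YangMills.Theorems.Prop7SymAvgTwSym (QTwS QTwS_apply_smul_one_of_regPr QTwS_smul_one_eq_QTwS_one_of_regPr)
open Summit.QuantumFields.YangMills.Theorems.Prop7RieszTauFrobNorm (sum_norm_sq_le_two_mul_opNorm_sq)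
open Summit.QuantumFields.YangMills.Theorems.Prop7QTwSectors (exists_sector_fields sum_normSq_entries_sectors)
open Summit.QuantumFields.YangMills.Theorems.Prop7LocalDivergenceComparison (sum_normSq_mul_le_opNorm_sq_mul sum_normSq_mul_le_mul_opNorm_sq sum_normSq_add_le)
open Summit.QuantumFields.YangMills.Theorems.Prop7QTwSLocalGaugeComparison (sum_normSq_QTwS_sub_conjR_QTwS_one_gauge_le)

/-! ## §1 Two Frobenius rows on `M₂(ℂ)` -/

/-- **HILBERT–SCHMIDT SUMS ARE `Ad_u`-INVARIANT FOR `u ∈ U1`** (`|u| ≤ 1`, `|u⁻¹| ≤ 1`): `Σ_{jk}|(uXu⁻¹)_{jk}|² = Σ_{jk}|X_{jk}|²` — each conjugation is non-expanding ([B7] (20)) and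
`Ad_{u⁻¹}` undoes `Ad_u`. [cite: Balaban1985Averaging, (18)–(20) p.21] -/
theorem sum_normSq_conjR_eq {u : (Matrix (Fin 2) (Fin 2) ℂ)ˣ} (hu : u ∈ U1 (Matrix (Fin 2) (Fin 2) ℂ)) (X : Matrix (Fin 2) (Fin 2) ℂ) :
    ∑ j, ∑ k, ‖(conjR u X) j k‖ ^ 2 = ∑ j, ∑ k, ‖X j k‖ ^ 2 := by
  have hnn : ∀ Y : Matrix (Fin 2) (Fin 2) ℂ, 0 ≤ ∑ j, ∑ k, ‖Y j k‖ ^ 2 := fun Y =>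
    Finset.sum_nonneg fun j _ => Finset.sum_nonneg fun k _ => sq_nonneg _
  have hle : ∀ (v : (Matrix (Fin 2) (Fin 2) ℂ)ˣ), v ∈ U1 (Matrix (Fin 2) (Fin 2) ℂ) → ∀ Y : Matrix (Fin 2) (Fin 2) ℂ,
      ∑ j, ∑ k, ‖(conjR v Y) j k‖ ^ 2 ≤ ∑ j, ∑ k, ‖Y j k‖ ^ 2 := by
    intro v hv Y
    obtain ⟨h1, h2⟩ := mem_U1.mp hv
    have hv1 : ‖(v : Matrix (Fin 2) (Fin 2) ℂ)‖ ^ 2 ≤ 1 := by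
      calc ‖(v : Matrix (Fin 2) (Fin 2) ℂ)‖ ^ 2 ≤ 1 ^ 2 := pow_le_pow_left₀ (norm_nonneg _) h1 2
        _ = 1 := one_pow 2
    have hv2 : ‖((v⁻¹ : (Matrix (Fin 2) (Fin 2) ℂ)ˣ) : Matrix (Fin 2) (Fin 2) ℂ)‖ ^ 2 ≤ 1 := by
      calc ‖((v⁻¹ : (Matrix (Fin 2) (Fin 2) ℂ)ˣ) : Matrix (Fin 2) (Fin 2) ℂ)‖ ^ 2 ≤ 1 ^ 2 := pow_le_pow_left₀ (norm_nonneg _) h2 2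
        _ = 1 := one_pow 2
    calc ∑ j, ∑ k, ‖(conjR v Y) j k‖ ^ 2
          = ∑ j, ∑ k, ‖(((v : Matrix (Fin 2) (Fin 2) ℂ) * Y) * ((v⁻¹ : (Matrix (Fin 2) (Fin 2) ℂ)ˣ) : Matrix (Fin 2) (Fin 2) ℂ)) j k‖ ^ 2 := by rw [conjR_apply]
      _ ≤ ‖((v⁻¹ : (Matrix (Fin 2) (Fin 2) ℂ)ˣ) : Matrix (Fin 2) (Fin 2) ℂ)‖ ^ 2 * ∑ j, ∑ k, ‖((v : Matrix (Fin 2) (Fin 2) ℂ) * Y) j k‖ ^ 2 :=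
          sum_normSq_mul_le_mul_opNorm_sq _ _
      _ ≤ 1 * ∑ j, ∑ k, ‖((v : Matrix (Fin 2) (Fin 2) ℂ) * Y) j k‖ ^ 2 := mul_le_mul_of_nonneg_right hv2 (hnn _)
      _ ≤ 1 * (‖(v : Matrix (Fin 2) (Fin 2) ℂ)‖ ^ 2 * ∑ j, ∑ k, ‖Y j k‖ ^ 2) := by rw [one_mul, one_mul]; exact sum_normSq_mul_le_opNorm_sq_mul _ _
      _ ≤ 1 * (1 * ∑ j, ∑ k, ‖Y j k‖ ^ 2) := by rw [one_mul, one_mul]; exact mul_le_mul_of_nonneg_right hv1 (hnn _)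
      _ = ∑ j, ∑ k, ‖Y j k‖ ^ 2 := by ring
  refine le_antisymm (hle u hu X) ?_
  have hback : conjR u⁻¹ (conjR u X) = X := by rw [conjR_conjR, inv_mul_cancel, one_conjR]
  calc ∑ j, ∑ k, ‖X j k‖ ^ 2 = ∑ j, ∑ k, ‖(conjR u⁻¹ (conjR u X)) j k‖ ^ 2 := by rw [hback]
    _ ≤ ∑ j, ∑ k, ‖(conjR u X) j k‖ ^ 2 := hle u⁻¹ ((U1 _).inv_mem hu) _

/-- A matrix with vanishing Hilbert–Schmidt sum vanishes. [folklore] -/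
theorem eq_zero_of_sum_normSq_eq_zero {M : Matrix (Fin 2) (Fin 2) ℂ} (hM : ∑ j, ∑ k, ‖M j k‖ ^ 2 = 0) : M = 0 := by
  ext j k
  have hj := (Finset.sum_eq_zero_iff_of_nonneg fun j _ => Finset.sum_nonneg fun k _ => sq_nonneg (‖M j k‖)).mp hM j (Finset.mem_univ j)
  have hk := (Finset.sum_eq_zero_iff_of_nonneg fun k _ => sq_nonneg (‖M j k‖)).mp hj k (Finset.mem_univ k)
  rw [Matrix.zero_apply, ← norm_eq_zero]
  exact pow_eq_zero_iff (two_ne_zero) |>.mp hk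

/-- **SECTOR COMPONENTS VANISH WHERE THE FIELD VANISHES**: if `A = A₁ + I•A₂ + τ•1` with `A₁, A₂` `𝔰𝔲(2)`-valued and `A b = 0`, then `A₁ b = 0` and `A₂ b = 0` (Pythagoras across the
three Hilbert–Schmidt-orthogonal sectors, ✓`sum_normSq_entries_sectors`). [cite: Balaban1985BackgroundPropagators, (3.11) p.392] -/
theorem sector_apply_eq_zero {ι : Type*} {A A₁ A₂ : ι → Matrix (Fin 2) (Fin 2) ℂ} {τ : ι → ℂ}
    (hA₁ : ∀ b, star (A₁ b) = -A₁ b ∧ (A₁ b).trace = 0) (hA₂ : ∀ b, star (A₂ b) = -A₂ b ∧ (A₂ b).trace = 0)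
    (hA : A = fun b => A₁ b + Complex.I • A₂ b + τ b • (1 : Matrix (Fin 2) (Fin 2) ℂ)) {b : ι} (hb : A b = 0) :
    A₁ b = 0 ∧ A₂ b = 0 := by
  have hsplit := sum_normSq_entries_sectors (hA₁ b) (hA₂ b) (τ b)
  have h0 : ∑ j : Fin 2, ∑ k : Fin 2, ‖(A₁ b + Complex.I • A₂ b + τ b • (1 : Matrix (Fin 2) (Fin 2) ℂ)) j k‖ ^ 2 = 0 := by
    have : A₁ b + Complex.I • A₂ b + τ b • (1 : Matrix (Fin 2) (Fin 2) ℂ) = A b := by rw [hA]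
    rw [this, hb]
    simp
  have hn1 : 0 ≤ ∑ j : Fin 2, ∑ k : Fin 2, ‖A₁ b j k‖ ^ 2 := Finset.sum_nonneg fun j _ => Finset.sum_nonneg fun k _ => sq_nonneg _
  have hn2 : 0 ≤ ∑ j : Fin 2, ∑ k : Fin 2, ‖A₂ b j k‖ ^ 2 := Finset.sum_nonneg fun j _ => Finset.sum_nonneg fun k _ => sq_nonneg _
  have hn3 : 0 ≤ ∑ j : Fin 2, ∑ k : Fin 2, ‖(τ b • (1 : Matrix (Fin 2) (Fin 2) ℂ)) j k‖ ^ 2 := Finset.sum_nonneg fun j _ => Finset.sum_nonneg fun k _ => sq_nonneg _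
  rw [hsplit] at h0
  exact ⟨eq_zero_of_sum_normSq_eq_zero (by linarith), eq_zero_of_sum_normSq_eq_zero (by linarith)⟩

/-! ## §2 The dictionary: an `SU(2)` gauge transformation read in the units of `M₂(ℂ)` -/

section Dictionary

variable {P : Params}

/-- `g(x) := σ(x)♭ ∈ U1` — unitaries are contractions with contractive inverses. [cite: Balaban1985Averaging, (19) p.21] -/
theorem toUnits_suIncl_mem_U1 (s : Matrix.specialUnitaryGroup (Fin 2) ℂ) :
    Unitary.toUnits (suIncl s) ∈ U1 (Matrix (Fin 2) (Fin 2) ℂ) :=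
  specialUnitaryUnits_le_U1 (by rw [mem_specialUnitaryUnits]; exact s.2)

/-- `Ad_{σ(x)♭} X = σ(x)·X·σ(x)*` — the units-conjugation of record IS the source conjugation of (L5a)∕(L5b). [cite: Balaban1985Averaging, (8) p.19, (19) p.21] -/
theorem conjR_toUnits_suIncl (s : Matrix.specialUnitaryGroup (Fin 2) ℂ) (X : Matrix (Fin 2) (Fin 2) ℂ) :
    conjR (Unitary.toUnits (suIncl s)) X = (s : Matrix (Fin 2) (Fin 2) ℂ) * X * star (s : Matrix (Fin 2) (Fin 2) ℂ) := by
  rw [conjR_apply]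
  rfl

/-- `(U₀♭)^{σ♭} = (U₀^σ)♭` — the units-valued gauge action of the units-valued reading is the reading of the `SU(2)` gauge action ([B7] (8)). [cite: Balaban1985Averaging, (8) p.19] -/
theorem gaugeActT_toUnits_suIncl (σ : GaugeTransf P 0 (Matrix.specialUnitaryGroup (Fin 2) ℂ)) (W : GaugeField P 0 (Matrix.specialUnitaryGroup (Fin 2) ℂ)) :
    gaugeActT (fun x => Unitary.toUnits (suIncl (σ x))) (unitsField (toUField W)) = unitsField (toUField (GaugeField.gaugeAct σ W)) := by
  funext b
  rw [gaugeActT_apply]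
  refine Units.ext ?_
  rw [Units.val_mul, Units.val_mul, val_unitsField, val_unitsField]
  rfl

/-- Matrix values: `((U₀^σ)♭ b : M₂) = (U₀^σ b : M₂)`. [cite: Balaban1985Averaging, (8) p.19] -/
theorem val_gaugeActT_toUnits_suIncl (σ : GaugeTransf P 0 (Matrix.specialUnitaryGroup (Fin 2) ℂ)) (W : GaugeField P 0 (Matrix.specialUnitaryGroup (Fin 2) ℂ)) (b : PBond P 0) :
    ((gaugeActT (fun x => Unitary.toUnits (suIncl (σ x))) (unitsField (toUField W)) b : (Matrix (Fin 2) (Fin 2) ℂ)ˣ) : Matrix (Fin 2) (Fin 2) ℂ)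
      = ((GaugeField.gaugeAct σ W b : Matrix.specialUnitaryGroup (Fin 2) ℂ) : Matrix (Fin 2) (Fin 2) ℂ) := by
  rw [gaugeActT_toUnits_suIncl]
  rfl

/-- `(τ•1)^σ = τ•1`: the scalar sector is gauge invariant (`σσ* = 1`). [folklore] -/
theorem conj_smul_one (s : Matrix.specialUnitaryGroup (Fin 2) ℂ) (t : ℂ) :
    (s : Matrix (Fin 2) (Fin 2) ℂ) * (t • (1 : Matrix (Fin 2) (Fin 2) ℂ)) * star (s : Matrix (Fin 2) (Fin 2) ℂ) = t • (1 : Matrix (Fin 2) (Fin 2) ℂ) := by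
  have hss : (s : Matrix (Fin 2) (Fin 2) ℂ) * star (s : Matrix (Fin 2) (Fin 2) ℂ) = 1 := Matrix.mem_unitaryGroup_iff.mp s.2.1
  rw [Matrix.mul_smul, Matrix.mul_one, Matrix.smul_mul, hss]

end Dictionary

/-! ## §3 The scalar sector: exactly flat and exactly gauge invariant -/

section Scalar

variable (F : T3Family) {n K : ℕ} (h : n ≤ K)

/-- **ON THE CENTRE THE (L5c) DIFFERENCE VANISHES IDENTICALLY**: at a printed-regular background (`RegPr`, `10¹²L³ε₀ ≤ 1`) `QTwS U₀ (τ•1) = QTwS 1 (τ•1)` is a central block field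
((Q-b) ✓`QTwS_apply_smul_one_of_regPr`), and `Ad_w` fixes the centre — for EVERY frame field `w`. [cite: Balaban1984PropagatorsI, (1.18) p.20; Balaban1985Averaging, (125)–(127) p.36] -/
theorem QTwS_smul_one_sub_conjR_QTwS_one_eq_zero {ε₀ : ℝ} (hε₀ : 0 < ε₀) (hε12 : 10 ^ 12 * (F.L : ℝ) ^ 3 * ε₀ ≤ 1)
    (W : GaugeField (F.P K) 0 (Matrix.specialUnitaryGroup (Fin 2) ℂ)) (hreg : RegPr F n K ε₀ W) (τ : PBond (F.P K) 0 → ℂ)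
    (w : PBond (F.P n) 0 → (Matrix (Fin 2) (Fin 2) ℂ)ˣ) (c' : PBond (F.P n) 0) :
    QTwS F n K h W (fun b => τ b • (1 : Matrix (Fin 2) (Fin 2) ℂ)) c' - conjR (w c') (QTwS F n K h (1 : GaugeField (F.P K) 0 (Matrix.specialUnitaryGroup (Fin 2) ℂ)) (fun b => τ b • (1 : Matrix (Fin 2) (Fin 2) ℂ)) c') = 0 := by
  have hc := QTwS_apply_smul_one_of_regPr F h hε₀ hε12 W hreg τ
  have h1 : QTwS F n K h (1 : GaugeField (F.P K) 0 (Matrix.specialUnitaryGroup (Fin 2) ℂ)) (fun b => τ b • (1 : Matrix (Fin 2) (Fin 2) ℂ)) = QTwS F n K h W (fun b => τ b • (1 : Matrix (Fin 2) (Fin 2) ℂ)) :=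
    (QTwS_smul_one_eq_QTwS_one_of_regPr F h hε₀ hε12 W hreg τ).symm
  rw [h1, hc]
  dsimp only
  rw [conjR_smul, conjR_one, sub_self]  -- `Ad_w(t•1) = t•1` (✓`Prop7DeltaEtaCurrentNormLowerBound.conjR_smul_one`, inlined)

end Scalar

/-! ## §4 ★★ FILE B for every `M₂(ℂ)`-valued field, in the Hilbert–Schmidt currency -/

section Carrier

variable (F : T3Family) (n K : ℕ) (h : n ≤ K)

/-- algebra: `(a₁ + I•a₂ + a₀) − (b₁ + I•b₂ + b₀) = (a₁ − b₁) + I•(a₂ − b₂)` when `a₀ = b₀`. [folklore] -/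
theorem three_sub_three (a₁ a₂ a₀ b₁ b₂ b₀ : Matrix (Fin 2) (Fin 2) ℂ) (h0 : a₀ - b₀ = 0) :
    (a₁ + Complex.I • a₂ + a₀) - (b₁ + Complex.I • b₂ + b₀) = (a₁ - b₁) + Complex.I • (a₂ - b₂) := by
  rw [sub_eq_zero] at h0
  rw [h0, smul_sub]
  abel

/-- entrywise: `Σ_{jk}|(I•M)_{jk}|² = Σ_{jk}|M_{jk}|²`. [folklore] -/
theorem sum_normSq_I_smul (M : Matrix (Fin 2) (Fin 2) ℂ) : ∑ j, ∑ k, ‖(Complex.I • M) j k‖ ^ 2 = ∑ j, ∑ k, ‖M j k‖ ^ 2 := by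
  refine Finset.sum_congr rfl fun j _ => Finset.sum_congr rfl fun k _ => ?_
  rw [Matrix.smul_apply, smul_eq_mul, norm_mul, Complex.norm_I, one_mul]

set_option maxHeartbeats 400000 in
/-- ★★ **(L5c) FOR ALL `M₂(ℂ)`-VALUED FIELDS, IN `SU(2)`-GAUGE LETTERS AND THE HILBERT–SCHMIDT CURRENCY.**  `RegPr F n K ε₀ U₀`, `10¹⁰L⁶ε₀ ≤ 1`, `10¹²L³ε₀ ≤ 1`; `σ` an `SU(2)` gauge
transformation, `δ ≥ 0`, `A : bonds → M₂(ℂ)` ARBITRARY, such that for every top bond `c`, offset `r` and `t < ℓ` with `A(b_{r,t}(c)) ≠ 0` the gauged background `U₀^σ` is `δ`-close to `1`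
on every bond of the comb `x₀(c) → x_r` and of the run `x_r → x_r + te` (`hgood`).  Then, with `(Ad_σA)(b) = σ(b₋)A(b)σ(b₋)*`, the (iv) frame `Φ(ĉ) = axialT U₀♭ x₀(ĉ) (embIter (K−n) ĉ₋)` and
`w(c') = Φ(ĉ)⁻¹·(σ(x₀(ĉ))♭)⁻¹` (`ĉ = bondShift (sites_eq F n K h) c'`):
`Σ_{c'} Σ_{jk} |(QTwS U₀ A c' − Ad_{w(c')}(QTwS 1 (Ad_σA) c'))_{jk}|² ≤ 4·(3·10¹⁰L¹⁰ε₀² + 192(ℓδ)²)·(ℓ²∕ℓ^d)·Σ_b Σ_{jk} |A(b)_{jk}|²`.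
PROOF: sectors `A = A₁ + I•A₂ + τ•1` (✓`exists_sector_fields`); FILE B ✓`sum_normSq_QTwS_sub_conjR_QTwS_one_gauge_le` on `A₁`, `A₂` with `g = σ♭` (§2); §3 on `τ•1`; ℂ-linearity;
`|X|² ≤ Σ|X_{jk}|² ≤ 2|X|²`; Pythagoras ✓`sum_normSq_entries_sectors`.
[cite: Balaban1985BackgroundPropagators, (3.13)-(3.15) p.393, Thm 3.11 p.416; Balaban1985Averaging, (18)-(20) p.21, Prop. 3 (124)-(126) p.36; Balaban1984PropagatorsI, (1.18)-(1.20) pp.19-20] -/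
theorem sum_normSq_entries_QTwS_sub_conjR_QTwS_one_conj_le {ε₀ : ℝ} (hε₀ : 0 < ε₀) (hε : 10 ^ 10 * (F.L : ℝ) ^ 6 * ε₀ ≤ 1) (hε12 : 10 ^ 12 * (F.L : ℝ) ^ 3 * ε₀ ≤ 1)
    (W : GaugeField (F.P K) 0 (Matrix.specialUnitaryGroup (Fin 2) ℂ)) (hreg : RegPr F n K ε₀ W)
    (σ : GaugeTransf (F.P K) 0 (Matrix.specialUnitaryGroup (Fin 2) ℂ)) {δ : ℝ} (hδ : 0 ≤ δ)
    (A : PBond (F.P K) 0 → Matrix (Fin 2) (Fin 2) ℂ)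
    (hgood : ∀ (c : PBond (F.P K) (K - n)) (r : Fin (F.P K).d → Fin ((F.P K).L ^ (K - n))) (t : ℕ), t < (F.P K).L ^ (K - n) →
      A ⟨(fun z : Site (F.P K) 0 => z.shift c.dir)^[t] (Site.fibreSite 0 (K - n) c.src r), c.dir⟩ ≠ 0 →
        (∀ st ∈ walk (Site.fibreSite 0 (K - n) c.src fun _ => (⟨0, pow_pos (F.P K).L_pos (K - n)⟩ : Fin ((F.P K).L ^ (K - n)))) (treeWord fun ν => ((r ν : ℕ) : ℤ)),
            ‖((GaugeField.gaugeAct σ W st.bond : Matrix.specialUnitaryGroup (Fin 2) ℂ) : Matrix (Fin 2) (Fin 2) ℂ) - 1‖ ≤ δ) ∧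
        (∀ st ∈ walk (Site.fibreSite 0 (K - n) c.src r) (List.replicate t (c.dir, true)),
            ‖((GaugeField.gaugeAct σ W st.bond : Matrix.specialUnitaryGroup (Fin 2) ℂ) : Matrix (Fin 2) (Fin 2) ℂ) - 1‖ ≤ δ)) :
    ∑ c' : PBond (F.P n) 0, ∑ j, ∑ k, ‖(QTwS F n K h W A c'
        - conjR ((axialT (unitsField (toUField W)) (Site.fibreSite 0 (K - n) (bondShift (sites_eq F n K h) c').src fun _ => (⟨0, pow_pos (F.P K).L_pos (K - n)⟩ : Fin ((F.P K).L ^ (K - n)))) (embIter (K - n) (bondShift (sites_eq F n K h) c').src))⁻¹ * (Unitary.toUnits (suIncl (σ (Site.fibreSite 0 (K - n) (bondShift (sites_eq F n K h) c').src fun _ => (⟨0, pow_pos (F.P K).L_pos (K - n)⟩ : Fin ((F.P K).L ^ (K - n)))))))⁻¹)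
            (QTwS F n K h (1 : GaugeField (F.P K) 0 (Matrix.specialUnitaryGroup (Fin 2) ℂ)) (fun b => ((σ b.src : Matrix.specialUnitaryGroup (Fin 2) ℂ) : Matrix (Fin 2) (Fin 2) ℂ) * A b * star ((σ b.src : Matrix.specialUnitaryGroup (Fin 2) ℂ) : Matrix (Fin 2) (Fin 2) ℂ)) c')) j k‖ ^ 2
      ≤ 4 * (3 * 10 ^ 10 * (F.L : ℝ) ^ 10 * ε₀ ^ 2 + 192 * ((F.L : ℝ) ^ (K - n) * δ) ^ 2)
          * (((F.L : ℝ) ^ (K - n)) ^ 2 / ((F.L : ℝ) ^ (K - n)) ^ (F.P K).d) * ∑ b : PBond (F.P K) 0, ∑ j, ∑ k, ‖A b j k‖ ^ 2 := by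
  classical
  -- §2: the dictionary
  have hg : ∀ x : Site (F.P K) 0, (fun x => Unitary.toUnits (suIncl (σ x))) x ∈ U1 (Matrix (Fin 2) (Fin 2) ℂ) := fun x => toUnits_suIncl_mem_U1 (σ x)
  have hval : ∀ b : PBond (F.P K) 0, ((gaugeActT (fun x => Unitary.toUnits (suIncl (σ x))) (unitsField (toUField W)) b : (Matrix (Fin 2) (Fin 2) ℂ)ˣ) : Matrix (Fin 2) (Fin 2) ℂ)
      = ((GaugeField.gaugeAct σ W b : Matrix.specialUnitaryGroup (Fin 2) ℂ) : Matrix (Fin 2) (Fin 2) ℂ) := val_gaugeActT_toUnits_suIncl σ W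
  -- the sectors of `A`
  obtain ⟨A₁, A₂, τ, hA₁, hA₂, hA⟩ := exists_sector_fields A
  have hsk₁ : ∀ b, (A₁ b)ᴴ = -A₁ b := fun b => by rw [← Matrix.star_eq_conjTranspose]; exact (hA₁ b).1
  have hsk₂ : ∀ b, (A₂ b)ᴴ = -A₂ b := fun b => by rw [← Matrix.star_eq_conjTranspose]; exact (hA₂ b).1
  -- `hgood` for the sector fields (they vanish wherever `A` does)
  have hgood' : ∀ (B : PBond (F.P K) 0 → Matrix (Fin 2) (Fin 2) ℂ), (∀ b, A b = 0 → B b = 0) →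
      ∀ (c : PBond (F.P K) (K - n)) (r : Fin (F.P K).d → Fin ((F.P K).L ^ (K - n))) (t : ℕ), t < (F.P K).L ^ (K - n) →
      B ⟨(fun z : Site (F.P K) 0 => z.shift c.dir)^[t] (Site.fibreSite 0 (K - n) c.src r), c.dir⟩ ≠ 0 →
        (∀ st ∈ walk (Site.fibreSite 0 (K - n) c.src fun _ => (⟨0, pow_pos (F.P K).L_pos (K - n)⟩ : Fin ((F.P K).L ^ (K - n)))) (treeWord fun ν => ((r ν : ℕ) : ℤ)),
            ‖(((gaugeActT (fun x => Unitary.toUnits (suIncl (σ x))) (unitsField (toUField W))) st.bond : (Matrix (Fin 2) (Fin 2) ℂ)ˣ) : Matrix (Fin 2) (Fin 2) ℂ) - 1‖ ≤ δ) ∧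
        (∀ st ∈ walk (Site.fibreSite 0 (K - n) c.src r) (List.replicate t (c.dir, true)),
            ‖(((gaugeActT (fun x => Unitary.toUnits (suIncl (σ x))) (unitsField (toUField W))) st.bond : (Matrix (Fin 2) (Fin 2) ℂ)ˣ) : Matrix (Fin 2) (Fin 2) ℂ) - 1‖ ≤ δ) := by
    intro B hB c r t ht hne
    obtain ⟨h1, h2⟩ := hgood c r t ht fun h0 => hne (hB _ h0)
    exact ⟨fun st hst => by rw [hval]; exact h1 st hst, fun st hst => by rw [hval]; exact h2 st hst⟩
  have hgood₁ := hgood' A₁ fun b hb => (sector_apply_eq_zero hA₁ hA₂ hA hb).1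
  have hgood₂ := hgood' A₂ fun b hb => (sector_apply_eq_zero hA₁ hA₂ hA hb).2
  -- FILE B on the two 𝔰𝔲(2) sectors
  have hB₁ := sum_normSq_QTwS_sub_conjR_QTwS_one_gauge_le F n K h hε₀ hε hε12 W hreg (fun x => Unitary.toUnits (suIncl (σ x))) hg hδ A₁ hsk₁ (fun b => (hA₁ b).2) hgood₁
  have hB₂ := sum_normSq_QTwS_sub_conjR_QTwS_one_gauge_le F n K h hε₀ hε hε12 W hreg (fun x => Unitary.toUnits (suIncl (σ x))) hg hδ A₂ hsk₂ (fun b => (hA₂ b).2) hgood₂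
  beta_reduce at hB₁ hB₂
  -- §3 on the scalar sector
  have hB₀ := QTwS_smul_one_sub_conjR_QTwS_one_eq_zero F h hε₀ hε12 W hreg τ
    (fun c' => ((axialT (unitsField (toUField W)) (Site.fibreSite 0 (K - n) (bondShift (sites_eq F n K h) c').src fun _ => (⟨0, pow_pos (F.P K).L_pos (K - n)⟩ : Fin ((F.P K).L ^ (K - n)))) (embIter (K - n) (bondShift (sites_eq F n K h) c').src))⁻¹ * (Unitary.toUnits (suIncl (σ (Site.fibreSite 0 (K - n) (bondShift (sites_eq F n K h) c').src fun _ => (⟨0, pow_pos (F.P K).L_pos (K - n)⟩ : Fin ((F.P K).L ^ (K - n)))))))⁻¹))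
  beta_reduce at hB₀
  -- the decomposition of the difference
  have hAf : A = A₁ + Complex.I • A₂ + (fun b => τ b • (1 : Matrix (Fin 2) (Fin 2) ℂ)) := by
    rw [hA]; funext b; simp only [Pi.add_apply, Pi.smul_apply]
  have hAσ : (fun b => ((σ b.src : Matrix.specialUnitaryGroup (Fin 2) ℂ) : Matrix (Fin 2) (Fin 2) ℂ) * A b * star ((σ b.src : Matrix.specialUnitaryGroup (Fin 2) ℂ) : Matrix (Fin 2) (Fin 2) ℂ))
      = (fun b => conjR ((fun x => Unitary.toUnits (suIncl (σ x))) b.src) (A₁ b)) + Complex.I • (fun b => conjR ((fun x => Unitary.toUnits (suIncl (σ x))) b.src) (A₂ b))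
        + (fun b => τ b • (1 : Matrix (Fin 2) (Fin 2) ℂ)) := by
    funext b
    simp only [Pi.add_apply, Pi.smul_apply]
    rw [hA, conjR_toUnits_suIncl, conjR_toUnits_suIncl]
    dsimp only
    rw [Matrix.mul_add, Matrix.mul_add, Matrix.add_mul, Matrix.add_mul, conj_smul_one, Matrix.mul_smul, Matrix.smul_mul]
  have hdec : ∀ c' : PBond (F.P n) 0, QTwS F n K h W A c'
        - conjR ((axialT (unitsField (toUField W)) (Site.fibreSite 0 (K - n) (bondShift (sites_eq F n K h) c').src fun _ => (⟨0, pow_pos (F.P K).L_pos (K - n)⟩ : Fin ((F.P K).L ^ (K - n)))) (embIter (K - n) (bondShift (sites_eq F n K h) c').src))⁻¹ * (Unitary.toUnits (suIncl (σ (Site.fibreSite 0 (K - n) (bondShift (sites_eq F n K h) c').src fun _ => (⟨0, pow_pos (F.P K).L_pos (K - n)⟩ : Fin ((F.P K).L ^ (K - n)))))))⁻¹)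
            (QTwS F n K h (1 : GaugeField (F.P K) 0 (Matrix.specialUnitaryGroup (Fin 2) ℂ)) (fun b => ((σ b.src : Matrix.specialUnitaryGroup (Fin 2) ℂ) : Matrix (Fin 2) (Fin 2) ℂ) * A b * star ((σ b.src : Matrix.specialUnitaryGroup (Fin 2) ℂ) : Matrix (Fin 2) (Fin 2) ℂ)) c')
      = (QTwS F n K h W A₁ c' - conjR ((axialT (unitsField (toUField W)) (Site.fibreSite 0 (K - n) (bondShift (sites_eq F n K h) c').src fun _ => (⟨0, pow_pos (F.P K).L_pos (K - n)⟩ : Fin ((F.P K).L ^ (K - n)))) (embIter (K - n) (bondShift (sites_eq F n K h) c').src))⁻¹ * (Unitary.toUnits (suIncl (σ (Site.fibreSite 0 (K - n) (bondShift (sites_eq F n K h) c').src fun _ => (⟨0, pow_pos (F.P K).L_pos (K - n)⟩ : Fin ((F.P K).L ^ (K - n)))))))⁻¹)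
            (QTwS F n K h (1 : GaugeField (F.P K) 0 (Matrix.specialUnitaryGroup (Fin 2) ℂ)) (fun b => conjR ((fun x => Unitary.toUnits (suIncl (σ x))) b.src) (A₁ b)) c'))
        + Complex.I • (QTwS F n K h W A₂ c' - conjR ((axialT (unitsField (toUField W)) (Site.fibreSite 0 (K - n) (bondShift (sites_eq F n K h) c').src fun _ => (⟨0, pow_pos (F.P K).L_pos (K - n)⟩ : Fin ((F.P K).L ^ (K - n)))) (embIter (K - n) (bondShift (sites_eq F n K h) c').src))⁻¹ * (Unitary.toUnits (suIncl (σ (Site.fibreSite 0 (K - n) (bondShift (sites_eq F n K h) c').src fun _ => (⟨0, pow_pos (F.P K).L_pos (K - n)⟩ : Fin ((F.P K).L ^ (K - n)))))))⁻¹)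
            (QTwS F n K h (1 : GaugeField (F.P K) 0 (Matrix.specialUnitaryGroup (Fin 2) ℂ)) (fun b => conjR ((fun x => Unitary.toUnits (suIncl (σ x))) b.src) (A₂ b)) c')) := by
    intro c'
    rw [hAσ]
    conv_lhs => rw [hAf]
    rw [map_add, map_add, map_smul, map_add, map_add, map_smul]
    simp only [Pi.add_apply, Pi.smul_apply]
    rw [conjR_add, conjR_add, conjR_smul]
    exact three_sub_three _ _ _ _ _ _ (hB₀ c')
  -- numerics
  have hL3 : (3 : ℝ) ≤ F.L := by
    have h3 : 3 ≤ F.L := by obtain ⟨a, ha⟩ := F.hL.1; have := F.hL.2; omega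
    exact_mod_cast h3
  have hL0 : (0 : ℝ) < F.L := by linarith
  set ρ : ℝ := (3 * 10 ^ 10 * (F.L : ℝ) ^ 10 * ε₀ ^ 2 + 192 * ((F.L : ℝ) ^ (K - n) * δ) ^ 2)
          * (((F.L : ℝ) ^ (K - n)) ^ 2 / ((F.L : ℝ) ^ (K - n)) ^ (F.P K).d) with hρ
  have hρ0 : 0 ≤ ρ := by positivity
  -- op-norm ≤ Hilbert–Schmidt on the right-hand sides of FILE B
  have hA₁le : ∑ b : PBond (F.P K) 0, ‖A₁ b‖ ^ 2 ≤ ∑ b : PBond (F.P K) 0, ∑ j, ∑ k, ‖A₁ b j k‖ ^ 2 :=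
    Finset.sum_le_sum fun b _ => MatrixNorms.opNorm_sq_le_sum_norm_sq (A₁ b)
  have hA₂le : ∑ b : PBond (F.P K) 0, ‖A₂ b‖ ^ 2 ≤ ∑ b : PBond (F.P K) 0, ∑ j, ∑ k, ‖A₂ b j k‖ ^ 2 :=
    Finset.sum_le_sum fun b _ => MatrixNorms.opNorm_sq_le_sum_norm_sq (A₂ b)
  -- Pythagoras across the sectors of `A`
  have hPy : ∑ b : PBond (F.P K) 0, ∑ j, ∑ k, ‖A₁ b j k‖ ^ 2 + ∑ b : PBond (F.P K) 0, ∑ j, ∑ k, ‖A₂ b j k‖ ^ 2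
      ≤ ∑ b : PBond (F.P K) 0, ∑ j, ∑ k, ‖A b j k‖ ^ 2 := by
    rw [← Finset.sum_add_distrib]
    refine Finset.sum_le_sum fun b _ => ?_
    have hb : A b = A₁ b + Complex.I • A₂ b + τ b • (1 : Matrix (Fin 2) (Fin 2) ℂ) := by rw [hA]
    rw [hb, sum_normSq_entries_sectors (hA₁ b) (hA₂ b) (τ b)]
    have : 0 ≤ ∑ j : Fin 2, ∑ k : Fin 2, ‖(τ b • (1 : Matrix (Fin 2) (Fin 2) ℂ)) j k‖ ^ 2 := Finset.sum_nonneg fun j _ => Finset.sum_nonneg fun k _ => sq_nonneg _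
    linarith
  -- assemble
  calc ∑ c' : PBond (F.P n) 0, ∑ j, ∑ k, ‖(QTwS F n K h W A c'
        - conjR ((axialT (unitsField (toUField W)) (Site.fibreSite 0 (K - n) (bondShift (sites_eq F n K h) c').src fun _ => (⟨0, pow_pos (F.P K).L_pos (K - n)⟩ : Fin ((F.P K).L ^ (K - n)))) (embIter (K - n) (bondShift (sites_eq F n K h) c').src))⁻¹ * (Unitary.toUnits (suIncl (σ (Site.fibreSite 0 (K - n) (bondShift (sites_eq F n K h) c').src fun _ => (⟨0, pow_pos (F.P K).L_pos (K - n)⟩ : Fin ((F.P K).L ^ (K - n)))))))⁻¹)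
            (QTwS F n K h (1 : GaugeField (F.P K) 0 (Matrix.specialUnitaryGroup (Fin 2) ℂ)) (fun b => ((σ b.src : Matrix.specialUnitaryGroup (Fin 2) ℂ) : Matrix (Fin 2) (Fin 2) ℂ) * A b * star ((σ b.src : Matrix.specialUnitaryGroup (Fin 2) ℂ) : Matrix (Fin 2) (Fin 2) ℂ)) c')) j k‖ ^ 2
      = ∑ c' : PBond (F.P n) 0, ∑ j, ∑ k, ‖((QTwS F n K h W A₁ c' - conjR ((axialT (unitsField (toUField W)) (Site.fibreSite 0 (K - n) (bondShift (sites_eq F n K h) c').src fun _ => (⟨0, pow_pos (F.P K).L_pos (K - n)⟩ : Fin ((F.P K).L ^ (K - n)))) (embIter (K - n) (bondShift (sites_eq F n K h) c').src))⁻¹ * (Unitary.toUnits (suIncl (σ (Site.fibreSite 0 (K - n) (bondShift (sites_eq F n K h) c').src fun _ => (⟨0, pow_pos (F.P K).L_pos (K - n)⟩ : Fin ((F.P K).L ^ (K - n)))))))⁻¹)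
            (QTwS F n K h (1 : GaugeField (F.P K) 0 (Matrix.specialUnitaryGroup (Fin 2) ℂ)) (fun b => conjR ((fun x => Unitary.toUnits (suIncl (σ x))) b.src) (A₁ b)) c'))
        + Complex.I • (QTwS F n K h W A₂ c' - conjR ((axialT (unitsField (toUField W)) (Site.fibreSite 0 (K - n) (bondShift (sites_eq F n K h) c').src fun _ => (⟨0, pow_pos (F.P K).L_pos (K - n)⟩ : Fin ((F.P K).L ^ (K - n)))) (embIter (K - n) (bondShift (sites_eq F n K h) c').src))⁻¹ * (Unitary.toUnits (suIncl (σ (Site.fibreSite 0 (K - n) (bondShift (sites_eq F n K h) c').src fun _ => (⟨0, pow_pos (F.P K).L_pos (K - n)⟩ : Fin ((F.P K).L ^ (K - n)))))))⁻¹)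
            (QTwS F n K h (1 : GaugeField (F.P K) 0 (Matrix.specialUnitaryGroup (Fin 2) ℂ)) (fun b => conjR ((fun x => Unitary.toUnits (suIncl (σ x))) b.src) (A₂ b)) c'))) j k‖ ^ 2 := by
          refine Finset.sum_congr rfl fun c' _ => ?_
          rw [hdec c']
    _ ≤ ∑ c' : PBond (F.P n) 0, (2 * ∑ j, ∑ k, ‖(QTwS F n K h W A₁ c' - conjR ((axialT (unitsField (toUField W)) (Site.fibreSite 0 (K - n) (bondShift (sites_eq F n K h) c').src fun _ => (⟨0, pow_pos (F.P K).L_pos (K - n)⟩ : Fin ((F.P K).L ^ (K - n)))) (embIter (K - n) (bondShift (sites_eq F n K h) c').src))⁻¹ * (Unitary.toUnits (suIncl (σ (Site.fibreSite 0 (K - n) (bondShift (sites_eq F n K h) c').src fun _ => (⟨0, pow_pos (F.P K).L_pos (K - n)⟩ : Fin ((F.P K).L ^ (K - n)))))))⁻¹)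
            (QTwS F n K h (1 : GaugeField (F.P K) 0 (Matrix.specialUnitaryGroup (Fin 2) ℂ)) (fun b => conjR ((fun x => Unitary.toUnits (suIncl (σ x))) b.src) (A₁ b)) c')) j k‖ ^ 2
        + 2 * ∑ j, ∑ k, ‖(QTwS F n K h W A₂ c' - conjR ((axialT (unitsField (toUField W)) (Site.fibreSite 0 (K - n) (bondShift (sites_eq F n K h) c').src fun _ => (⟨0, pow_pos (F.P K).L_pos (K - n)⟩ : Fin ((F.P K).L ^ (K - n)))) (embIter (K - n) (bondShift (sites_eq F n K h) c').src))⁻¹ * (Unitary.toUnits (suIncl (σ (Site.fibreSite 0 (K - n) (bondShift (sites_eq F n K h) c').src fun _ => (⟨0, pow_pos (F.P K).L_pos (K - n)⟩ : Fin ((F.P K).L ^ (K - n)))))))⁻¹)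
            (QTwS F n K h (1 : GaugeField (F.P K) 0 (Matrix.specialUnitaryGroup (Fin 2) ℂ)) (fun b => conjR ((fun x => Unitary.toUnits (suIncl (σ x))) b.src) (A₂ b)) c')) j k‖ ^ 2) := by
          refine Finset.sum_le_sum fun c' _ => ?_
          refine (sum_normSq_add_le _ _).trans ?_
          rw [sum_normSq_I_smul]
    _ ≤ ∑ c' : PBond (F.P n) 0, (2 * (2 * ‖QTwS F n K h W A₁ c' - conjR ((axialT (unitsField (toUField W)) (Site.fibreSite 0 (K - n) (bondShift (sites_eq F n K h) c').src fun _ => (⟨0, pow_pos (F.P K).L_pos (K - n)⟩ : Fin ((F.P K).L ^ (K - n)))) (embIter (K - n) (bondShift (sites_eq F n K h) c').src))⁻¹ * (Unitary.toUnits (suIncl (σ (Site.fibreSite 0 (K - n) (bondShift (sites_eq F n K h) c').src fun _ => (⟨0, pow_pos (F.P K).L_pos (K - n)⟩ : Fin ((F.P K).L ^ (K - n)))))))⁻¹)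
            (QTwS F n K h (1 : GaugeField (F.P K) 0 (Matrix.specialUnitaryGroup (Fin 2) ℂ)) (fun b => conjR ((fun x => Unitary.toUnits (suIncl (σ x))) b.src) (A₁ b)) c')‖ ^ 2)
        + 2 * (2 * ‖QTwS F n K h W A₂ c' - conjR ((axialT (unitsField (toUField W)) (Site.fibreSite 0 (K - n) (bondShift (sites_eq F n K h) c').src fun _ => (⟨0, pow_pos (F.P K).L_pos (K - n)⟩ : Fin ((F.P K).L ^ (K - n)))) (embIter (K - n) (bondShift (sites_eq F n K h) c').src))⁻¹ * (Unitary.toUnits (suIncl (σ (Site.fibreSite 0 (K - n) (bondShift (sites_eq F n K h) c').src fun _ => (⟨0, pow_pos (F.P K).L_pos (K - n)⟩ : Fin ((F.P K).L ^ (K - n)))))))⁻¹)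
            (QTwS F n K h (1 : GaugeField (F.P K) 0 (Matrix.specialUnitaryGroup (Fin 2) ℂ)) (fun b => conjR ((fun x => Unitary.toUnits (suIncl (σ x))) b.src) (A₂ b)) c')‖ ^ 2)) := by
          refine Finset.sum_le_sum fun c' _ => ?_
          gcongr
          · exact sum_norm_sq_le_two_mul_opNorm_sq _
          · exact sum_norm_sq_le_two_mul_opNorm_sq _
    _ = 4 * (∑ c' : PBond (F.P n) 0, ‖QTwS F n K h W A₁ c' - conjR ((axialT (unitsField (toUField W)) (Site.fibreSite 0 (K - n) (bondShift (sites_eq F n K h) c').src fun _ => (⟨0, pow_pos (F.P K).L_pos (K - n)⟩ : Fin ((F.P K).L ^ (K - n)))) (embIter (K - n) (bondShift (sites_eq F n K h) c').src))⁻¹ * (Unitary.toUnits (suIncl (σ (Site.fibreSite 0 (K - n) (bondShift (sites_eq F n K h) c').src fun _ => (⟨0, pow_pos (F.P K).L_pos (K - n)⟩ : Fin ((F.P K).L ^ (K - n)))))))⁻¹)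
            (QTwS F n K h (1 : GaugeField (F.P K) 0 (Matrix.specialUnitaryGroup (Fin 2) ℂ)) (fun b => conjR ((fun x => Unitary.toUnits (suIncl (σ x))) b.src) (A₁ b)) c')‖ ^ 2)
        + 4 * (∑ c' : PBond (F.P n) 0, ‖QTwS F n K h W A₂ c' - conjR ((axialT (unitsField (toUField W)) (Site.fibreSite 0 (K - n) (bondShift (sites_eq F n K h) c').src fun _ => (⟨0, pow_pos (F.P K).L_pos (K - n)⟩ : Fin ((F.P K).L ^ (K - n)))) (embIter (K - n) (bondShift (sites_eq F n K h) c').src))⁻¹ * (Unitary.toUnits (suIncl (σ (Site.fibreSite 0 (K - n) (bondShift (sites_eq F n K h) c').src fun _ => (⟨0, pow_pos (F.P K).L_pos (K - n)⟩ : Fin ((F.P K).L ^ (K - n)))))))⁻¹)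
            (QTwS F n K h (1 : GaugeField (F.P K) 0 (Matrix.specialUnitaryGroup (Fin 2) ℂ)) (fun b => conjR ((fun x => Unitary.toUnits (suIncl (σ x))) b.src) (A₂ b)) c')‖ ^ 2) := by
          rw [Finset.sum_add_distrib, ← Finset.mul_sum, ← Finset.mul_sum, ← Finset.mul_sum, ← Finset.mul_sum]
          ring
    _ ≤ 4 * (ρ * ∑ b : PBond (F.P K) 0, ‖A₁ b‖ ^ 2) + 4 * (ρ * ∑ b : PBond (F.P K) 0, ‖A₂ b‖ ^ 2) := by
          rw [hρ]; gcongr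
    _ ≤ 4 * (ρ * ∑ b : PBond (F.P K) 0, ∑ j, ∑ k, ‖A₁ b j k‖ ^ 2) + 4 * (ρ * ∑ b : PBond (F.P K) 0, ∑ j, ∑ k, ‖A₂ b j k‖ ^ 2) := by gcongr
    _ = 4 * ρ * (∑ b : PBond (F.P K) 0, ∑ j, ∑ k, ‖A₁ b j k‖ ^ 2 + ∑ b : PBond (F.P K) 0, ∑ j, ∑ k, ‖A₂ b j k‖ ^ 2) := by ring
    _ ≤ 4 * ρ * ∑ b : PBond (F.P K) 0, ∑ j, ∑ k, ‖A b j k‖ ^ 2 := mul_le_mul_of_nonneg_left hPy (by positivity)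
    _ = _ := by rw [hρ]; ring

end Carrier

end Summit.QuantumFields.YangMills.Theorems.Prop7QTwSLocalGaugeComparisonAllFields

end
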